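/-
Copyright (c) 2026 the pub-hodgecm-mathlib formalisation cell (harness21).  Prover seat hodgecm-mathlib-LH4-p06 (g5), Track A «(D-RAM) FOUR-FRAME», unit U2H, census leaf
(ρ2b′-X) `stub_U2H_fixedPointCensus_typeTwo_unit0` — SOCKET (C) `orderCountCensusC` (type RamM), hand (C-2TOPnear) of LH4-p04 (g5)'s T5s-RamM EDITION 2 (`hvTopNear`,
SOCKET (C) LEAD LINES #5–#6): the NEAR top cells of the two tables AGREE, class-free.  2026-09-04.
-/
import Summits.HodgeConjecture.HodgeConjecture.Theorems.F0P3cDyRamToricLevelCensusRamMTopCellsPrep   -- ★ p858084 (this seat): `v_twist_thetaFixed_sub_one_le`; brings ★ Side p857841 (threshold), ★ TopPrep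
import Summits.HodgeConjecture.HodgeConjecture.Theorems.F0P3cDyRamToricLevelCensusRamMTop            -- ★ p857665 (this seat): `ncard_levelSetDep_top_eq_of_ramified` (the (D3) quotient form)
import HarnessLib

/-!
# T5c (C-2TOPnear): on the coincidence diagonal, BELOW the non-norm threshold, `#levelSetDep_h(j,a;μ) = #levelSetDep_{h′}(j,a;μ)` — for ANY pair of classes that differ by `ψ(n₀)`

Cell `hodgecm-mathlib` (D-0151), FLOOR 0, crux H413 = `stmt-HodgeConjecture-24833`; squad F0∕P3c∕LH4; lane `--supports stmt-HodgeConjecture-24833 --as helper` (count-neutral).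
THEOREMS ONLY (no `def`, no instance, no notation, no `sorry`, default heartbeats).  Socket served: LH4-p04 (g5)'s SOCKET (C), T5s-RamM EDITION 2 `toricCensusSum_ramM_v2` letter
**`hvTopNear : ¬GEN → j + m = jλ + a → j + a + 2 ≤ m + s0 + 2g → vP j a = vM j a`** — on the near top cells the census sum only needs the two tables to AGREE, on the even-class
diagonal (parity rows) AND on the odd-class diagonal (the realised off-parity rows `jλ = m + s0 − 1`, where no translator∕anchor exists and the T∕E law of ★ p858107 is silent).
THIS FILE proves the agreement WITHOUT any law: by ★ `ncard_levelSetDep_top_eq_of_ramified` both counts are `if χ_η then q^j ∕ [U : B_s] else 0` with the literal (D3) bit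
`χ_η :⟺ ∃ ω₁ ∈ U_M, |1 + (η∕κ)·t(ω₁)| ≤ s` of the cell's class `η`; if the `−` line's class is the `n₀`-twist of the `+` line's class (`η′ = η·ψ(n₀)·t(ω_r)`, the RELATIVE class
letter of (C-1cls)) and `ψ(n₀)` itself is `s`-close to a unit twist (★ `anchored_twist_near_iff_lt_threshold`: exactly below the threshold `k′ + 2 ≤ dΘ`, i.e. `j + a + 2 ≤ m + s0 + 2g`;
automatic below K♮-level `0` by ★ `v_twist_thetaFixed_sub_one_le`), then `χ_η ⟺ χ_{η′}` by twist multiplicativity (`t(ω₁ω₂∕ω_r) = t(ω₁)t(ω₂)∕t(ω_r)`, ultrametric).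
* §1 `normTwist_mul`, `v_eq_one_of_v_one_add_lt`, **`topBitLit_iff_of_rel`** (the class-change lemma at any radius `s < 1`);
* §2 **`ncard_levelSetDep_top_eq_of_near`** — the letter, in `ℕ`, for any `μ` with the tokens, any scalars `h, h′` with diagonal classes related by `hrel`.
HONEST LABEL.  Count-neutral (`--supports`); unconditional local algebra; nothing of (ρ2b′-X) is asserted — `HC_CM` is proved only modulo the 7 printed citations (2 remaining named
inputs: hLiu418 = `stmt-HodgeConjecture-24832`, h413 = `stmt-HodgeConjecture-24833`) until rung 0 closes.

## References
* [Jacobowitz1962] R. Jacobowitz, *Hermitian forms over local fields*, Amer. J. Math. 84 (1962): §4 (lattice classes under the unitary twists).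
* [Serre1979] J.-P. Serre, *Local Fields*, GTM 67 (1979): Ch. V §1; Ch. V §3 Cor. 3 (the norm index two on the unit filtration).
* [Flicker1998UnitaryFL] Y. Z. Flicker, *Elementary proof of the fundamental lemma for a unitary group*, Canad. J. Math. 50 (1998): Prop. 7 p. 84.
-/

set_option autoImplicit false

noncomputable section

namespace Summit.HodgeConjecture.HodgeConjecture.Cruxes.H413.F0P3cDyRamToricLevelCensusRamM

open WithZero IsLocalRing
open scoped Valued
open Literature.NumberTheory.Automorphic.UnitaryThreeFourFrame (IsRamifiedQuadraticDatum)
open Literature.NumberTheory.LocalFields.QuadraticOrder Literature.NumberTheory.LocalFields.WildQuadraticDatum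
open Summit.HodgeConjecture.HodgeConjecture.Cruxes.H413.F0P3cDyRamToricCensusDefs

variable {K : Type} [Field K] [Valued K ℤᵐ⁰] {ρ Θ : K →+* K} {α ϖE h h' : K} {dρ t : ℕ}
variable {K' : Type*} [Field K'] [Valued K' ℤᵐ⁰] {σ' : K' →+* K'} {π' : K'} {d' : ℕ}

/-! ## §1 The class-change lemma for the literal (D3) bit -/

omit [Valued K ℤᵐ⁰] in
/-- Twist multiplicativity: `t(xy) = t(x)·t(y)` (`t(x) = ρN(x)∕N(x)`, `N(x) = xΘx`). [cite: Jacobowitz1962, §4] -/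
theorem normTwist_mul (x y : K) : ρ (x * y * Θ (x * y)) / (x * y * Θ (x * y)) = (ρ (x * Θ x) / (x * Θ x)) * (ρ (y * Θ y) / (y * Θ y)) := by
  rw [map_mul Θ, show x * y * (Θ x * Θ y) = (x * Θ x) * (y * Θ y) by ring, map_mul ρ, mul_div_mul_comm]

/-- `|1 + A| < 1 ⇒ |A| = 1`. [cite: Serre1979, Ch. V §1] -/
theorem v_eq_one_of_v_one_add_lt {A : K} (h1 : Valued.v (1 + A) < 1) : Valued.v A = 1 := by
  have h2 : A = (1 + A) + (-1) := by ring
  rw [h2, Valuation.map_add_eq_of_lt_right _ (by rw [Valuation.map_neg, Valuation.map_one]; exact h1), Valuation.map_neg, Valuation.map_one]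

/-- **THE CLASS-CHANGE LEMMA.**  At a radius `s < 1`: if `η′ = η·ψ·t(ω_r)` for a unit `ω_r` and a scalar `ψ` that is itself `s`-close to a unit twist (`∃ ω₂ ∈ U_M, |ψ·t(ω₂) − 1| ≤ s`),
then the literal (D3) bits of the classes `η` and `η′` against the same `κ` agree: `(∃ ω₁ ∈ U_M, |1 + (η∕κ)t(ω₁)| ≤ s) ⟺ (∃ ω₁ ∈ U_M, |1 + (η′∕κ)t(ω₁)| ≤ s)`
(`ω₁ ↦ ω₁ω₂∕ω_r`, resp. `ω₁ω_r∕ω₂`; `1 + A(1 + e) = (1 + A) + Ae`). [cite: Jacobowitz1962, §4] [cite: Serre1979, Ch. V §1] -/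
theorem topBitLit_iff_of_rel (hvρ : ∀ x, Valued.v (ρ x) = Valued.v x)
    {η η' κ ψ : K} {ω_r : Kˣ} (hω_r : Valued.v (ω_r : K) = 1) (hrel : η' = η * ψ * (ρ ((ω_r : K) * Θ ω_r) / ((ω_r : K) * Θ ω_r)))
    {s : ℤᵐ⁰} (hs : s < 1) (hψ : ∃ ω₂ : K, Valued.v ω₂ = 1 ∧ Valued.v (ψ * (ρ (ω₂ * Θ ω₂) / (ω₂ * Θ ω₂)) - 1) ≤ s) :
    (∃ ω₁ : Kˣ, Valued.v (ω₁ : K) = 1 ∧ Valued.v (1 + η / κ * (ρ ((ω₁ : K) * Θ ω₁) / ((ω₁ : K) * Θ ω₁))) ≤ s) ↔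
      ∃ ω₁ : Kˣ, Valued.v (ω₁ : K) = 1 ∧ Valued.v (1 + η' / κ * (ρ ((ω₁ : K) * Θ ω₁) / ((ω₁ : K) * Θ ω₁))) ≤ s := by
  obtain ⟨ω₂, hω₂, he⟩ := hψ
  have hω₂0 : ω₂ ≠ 0 := fun h0 => by rw [h0, map_zero] at hω₂; exact zero_ne_one hω₂
  have hωr0 : (ω_r : K) ≠ 0 := ω_r.ne_zero
  have htr : ρ ((ω_r : K) * Θ ω_r) / ((ω_r : K) * Θ ω_r) ≠ 0 := by
    rw [← (Valuation.ne_zero_iff Valued.v), v_normTwist_eq_one hvρ hωr0]; exact one_ne_zero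
  have ht₂ : ρ (ω₂ * Θ ω₂) / (ω₂ * Θ ω₂) ≠ 0 := by
    rw [← (Valuation.ne_zero_iff Valued.v), v_normTwist_eq_one hvρ hω₂0]; exact one_ne_zero
  have hE1 : Valued.v (ψ * (ρ (ω₂ * Θ ω₂) / (ω₂ * Θ ω₂))) = 1 := by
    have h1 : ψ * (ρ (ω₂ * Θ ω₂) / (ω₂ * Θ ω₂)) = 1 + (ψ * (ρ (ω₂ * Θ ω₂) / (ω₂ * Θ ω₂)) - 1) := by ring
    rw [h1]; exact Valuation.map_one_add_of_lt _ (he.trans_lt hs)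
  -- the key estimate: `|1 + A| ≤ s`, `|X − 1| ≤ s`, `|X| = 1` ⇒ `|1 + A·X| ≤ s` and `|1 + A∕X| ≤ s`
  have key : ∀ {A X : K}, Valued.v (1 + A) ≤ s → Valued.v (X - 1) ≤ s → Valued.v X = 1 →
      Valued.v (1 + A * X) ≤ s ∧ Valued.v (1 + A / X) ≤ s := fun {A X} hA hX hX1 => by
    have hA1 : Valued.v A = 1 := v_eq_one_of_v_one_add_lt (hA.trans_lt hs)
    have hX0 : X ≠ 0 := fun h0 => by rw [h0, map_zero] at hX1; exact zero_ne_one hX1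
    constructor
    · have h1 : 1 + A * X = (1 + A) + A * (X - 1) := by ring
      rw [h1]
      refine (Valuation.map_add _ _ _).trans (max_le hA ?_)
      rw [map_mul, hA1, one_mul]; exact hX
    · have h1 : 1 + A / X = ((1 + A) + (X - 1)) / X := by field_simp; ring
      rw [h1, map_div₀, hX1, div_one]
      exact (Valuation.map_add _ _ _).trans (max_le hA hX)
  constructor
  · rintro ⟨ω₁, hω₁, hle⟩
    have hω₁0 : (ω₁ : K) ≠ 0 := ω₁.ne_zero
    have hne : (ω₁ : K) * ω₂ * (ω_r : K)⁻¹ ≠ 0 := mul_ne_zero (mul_ne_zero hω₁0 hω₂0) (inv_ne_zero hωr0)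
    refine ⟨Units.mk0 _ hne, by rw [Units.val_mk0, map_mul, map_mul, map_inv₀, hω₁, hω₂, hω_r, inv_one, mul_one, mul_one], ?_⟩
    rw [Units.val_mk0, show (ω₁ : K) * ω₂ * (ω_r : K)⁻¹ = ((ω₁ : K) * ω₂) * (ω_r : K)⁻¹ by ring, normTwist_mul, normTwist_mul, normTwist_inv, hrel]
    have h1 : 1 + η * ψ * (ρ ((ω_r : K) * Θ ω_r) / ((ω_r : K) * Θ ω_r)) / κ *
          (ρ ((ω₁ : K) * Θ ω₁) / ((ω₁ : K) * Θ ω₁) * (ρ (ω₂ * Θ ω₂) / (ω₂ * Θ ω₂)) * (ρ ((ω_r : K) * Θ ω_r) / ((ω_r : K) * Θ ω_r))⁻¹) =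
        1 + η / κ * (ρ ((ω₁ : K) * Θ ω₁) / ((ω₁ : K) * Θ ω₁)) * (ψ * (ρ (ω₂ * Θ ω₂) / (ω₂ * Θ ω₂))) := by
      field_simp
    rw [h1]
    exact (key hle he hE1).1
  · rintro ⟨ω₁, hω₁, hle⟩
    have hω₁0 : (ω₁ : K) ≠ 0 := ω₁.ne_zero
    have hne : (ω₁ : K) * (ω_r : K) * ω₂⁻¹ ≠ 0 := mul_ne_zero (mul_ne_zero hω₁0 hωr0) (inv_ne_zero hω₂0)
    refine ⟨Units.mk0 _ hne, by rw [Units.val_mk0, map_mul, map_mul, map_inv₀, hω₁, hω₂, hω_r, inv_one, mul_one, mul_one], ?_⟩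
    rw [Units.val_mk0, show (ω₁ : K) * (ω_r : K) * ω₂⁻¹ = ((ω₁ : K) * (ω_r : K)) * ω₂⁻¹ by ring, normTwist_mul, normTwist_mul, normTwist_inv]
    rw [hrel] at hle
    have h1 : 1 + η / κ * (ρ ((ω₁ : K) * Θ ω₁) / ((ω₁ : K) * Θ ω₁) * (ρ ((ω_r : K) * Θ ω_r) / ((ω_r : K) * Θ ω_r)) * (ρ (ω₂ * Θ ω₂) / (ω₂ * Θ ω₂))⁻¹) =
        1 + η * ψ * (ρ ((ω_r : K) * Θ ω_r) / ((ω_r : K) * Θ ω_r)) / κ * (ρ ((ω₁ : K) * Θ ω₁) / ((ω₁ : K) * Θ ω₁)) /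
          (ψ * (ρ (ω₂ * Θ ω₂) / (ω₂ * Θ ω₂))) := by
      have hψ0 : ψ ≠ 0 := fun h0 => by rw [h0, zero_mul, map_zero] at hE1; exact zero_ne_one hE1
      field_simp
    rw [h1]
    exact (key hle he hE1).2


/-! ## §2 `hvTopNear`: the near top cells of the two tables agree -/

/-- **`hvTopNear` OF ★ `toricCensusSum_ramM_v2`.**  Frame: ρ-datum, `Θ` an isometric involution commuting with `ρ`, `|ϖE| = exp(−2)`, `ρϖE = ϖE`, `#𝓀_M = q`; the third-field
package (for the threshold) with the `Θ`-datum, `hFN`, a `Θ`-fixed unit NON-norm `n₀`; two scalars `h, h′ ≠ 0` with `|h| = exp(−v_h)`, `|h′| = exp(−v_{h′})`; tokens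
`|μ| = |ϖE|^m`, `|μ − ρμ| = |ϖE^{jλ}(α − ρα)|` (any `μ`); dictionary `dΘ = 2g`, `2d′ = d_ρ + 2s0`; the two DIAGONAL classes `η = (ρh∕h)·t(α^{k₀})`, `η′ = (ρh′∕h′)·t(α^{k₀′})`
(`v_h + d_ρ + 2k₀ + 2jλ = 2m`, `v_{h′} + d_ρ + 2k₀′ + 2jλ = 2m`) RELATED by `η′ = η·ψ(n₀)·t(ω_r)` (the relative class letter of (C-1cls)).  Then on every cell of the diagonal
`j + m = jλ + a` with `¬GEN` and `j + a + 2 ≤ m + s0 + 2g` (below the non-norm threshold): **`#levelSetDep_h(j,a;μ) = #levelSetDep_{h′}(j,a;μ)`** — on either parity of the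
diagonal's class. [cite: Jacobowitz1962, §4] [cite: Serre1979, Ch. V §3 Cor. 3] [cite: Flicker1998UnitaryFL, Prop. 7 p. 84] -/
theorem ncard_levelSetDep_top_eq_of_near [CompleteSpace K] [IsDiscreteValuationRing 𝒪[K]] [Finite 𝓀[K]]
    (hD : IsRamifiedQuadraticDatum ρ α dρ t) (hΘρ : ∀ x, Θ (ρ x) = ρ (Θ x)) (hvΘ : ∀ x, Valued.v (Θ x) = Valued.v x)
    (hϖE : Valued.v ϖE = exp (-2 : ℤ)) (hρϖ : ρ ϖE = ϖE) {q : ℕ} (hq : Nat.card 𝓀[K] = q)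
    (hσ' : ∀ x, σ' (σ' x) = x) (hvσ' : ∀ x, Valued.v (σ' x) = Valued.v x) (hfix' : ∀ x : K', σ' x = x → x ≠ 0 → ∃ n : ℤ, Valued.v x = exp (2 * n))
    (hπ' : Valued.v π' = exp (-1 : ℤ)) (hdd' : Valued.v (π' - σ' π') = Valued.v π' ^ d')
    (jK : K' →+* K) (hjle : ∀ x y : K', Valued.v (jK x) ≤ Valued.v (jK y) ↔ Valued.v x ≤ Valued.v y) (hjΘ : ∀ x, Θ (jK x) = jK x)
    (hjfix : ∀ z : K, Θ z = z → ∃ x, jK x = z) (hjσ : ∀ x, jK (σ' x) = ρ (jK x)) (hjπ : Valued.v (jK π') = exp (-2 : ℤ))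
    {ϖ : K} {dΘ tΘ : ℕ} (hDΘ : IsRamifiedQuadraticDatum Θ ϖ dΘ tΘ)
    (hFN : ∀ f : K, ρ f = f → Θ f = f → Valued.v f = 1 → ∃ x : K, x * Θ x = f)
    {n₀ : K} (hΘn₀ : Θ n₀ = n₀) (hn₀1 : Valued.v n₀ = 1) (hn₀N : ¬ ∃ z : K, z * Θ z = n₀)
    (hh : h ≠ 0) {vh : ℤ} (hvh : Valued.v h = exp (-vh)) (hh' : h' ≠ 0) {vh' : ℤ} (hvh' : Valued.v h' = exp (-vh'))
    {μ : K} {m jl : ℕ} (hμ : Valued.v μ = Valued.v ϖE ^ m) (hjl : Valued.v (μ - ρ μ) = Valued.v (ϖE ^ jl * (α - ρ α)))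
    {g s0 : ℕ} (hg : dΘ = 2 * g) (hds : 2 * d' = dρ + 2 * s0)
    {k₀ k₀' : ℤ} (hk₀ : vh + dρ + 2 * k₀ + 2 * jl = 2 * m) (hk₀' : vh' + dρ + 2 * k₀' + 2 * jl = 2 * m)
    {ω_r : Kˣ} (hω_r : Valued.v (ω_r : K) = 1)
    (hrel : ρ h' / h' * (ρ (α ^ k₀' * Θ (α ^ k₀')) / (α ^ k₀' * Θ (α ^ k₀'))) =
      ρ h / h * (ρ (α ^ k₀ * Θ (α ^ k₀)) / (α ^ k₀ * Θ (α ^ k₀))) * (ρ n₀ / n₀) * (ρ ((ω_r : K) * Θ ω_r) / ((ω_r : K) * Θ ω_r)))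
    {j a : ℕ} (hj : j ≤ jl) (hng : ¬ (a ≤ m ∧ (j + a ≤ m ∨ (2 * a ≤ m ∧ j + a ≤ jl)))) (hdiag : j + m = jl + a) (hnear : j + a + 2 ≤ m + s0 + 2 * g) :
    (levelSetDep ρ Θ α ϖE h j a μ).ncard = (levelSetDep ρ Θ α ϖE h' j a μ).ncard := by
  classical
  have hΘΘ := hDΘ.1
  have hvρ := hD.2.1
  have htop : m + 1 ≤ 2 * a := by omega
  obtain ⟨U, hU⟩ := Literature.NumberTheory.LocalFields.WildQuadraticDatum.exists_subgroup_v_eq_one (K := K)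
  obtain ⟨H, hH⟩ := exists_subgroup_orderUnits (ρ := ρ) (α := α) hvρ (ϖE ^ j)
  obtain ⟨B, hB⟩ := exists_subgroup_normDepth (Θ := Θ) hvρ hvΘ (exp (2 * (m : ℤ) - 2 * a - 2 * j - dρ))
  rw [ncard_levelSetDep_top_eq_of_ramified hD hΘΘ hΘρ hvΘ hϖE hρϖ hq hh hvh hμ hjl hj hdiag htop (k₀ := k₀) (by omega) U H B hU hH hB,
    ncard_levelSetDep_top_eq_of_ramified hD hΘΘ hΘρ hvΘ hϖE hρϖ hq hh' hvh' hμ hjl hj hdiag htop (k₀ := k₀') (by omega) U H B hU hH hB]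
  -- `ψ(n₀)` is close to a unit twist at the cell's radius: trivially below K♮-level `0`, by the threshold ★ up to `k′ + 2 ≤ dΘ`
  have hψ : ∃ ω₂ : K, Valued.v ω₂ = 1 ∧ Valued.v (ρ n₀ / n₀ * (ρ (ω₂ * Θ ω₂) / (ω₂ * Θ ω₂)) - 1) ≤ exp (2 * (m : ℤ) - 2 * a - 2 * j - dρ) := by
    by_cases hlow : j + a < m + s0
    · refine ⟨1, Valuation.map_one _, ?_⟩
      rw [one_mul, map_one, map_one, div_one, mul_one]
      refine (v_twist_thetaFixed_sub_one_le hσ' hfix' hπ' hdd' jK hjle hjfix hjσ hjπ hΘn₀ hn₀1).trans ?_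
      rw [exp_le_exp]; omega
    · have hR : Valued.v (jK π' ^ (d' + (j + a - m - s0))) = exp (2 * (m : ℤ) - 2 * a - 2 * j - dρ) := by
        rw [v_map_pow_eq_exp_neg_two_mul jK hjπ]; congr 1; omega
      rw [← hR]
      exact (anchored_twist_near_iff_lt_threshold hvΘ hσ' hvσ' hfix' hπ' hdd' jK hjle hjΘ hjfix hjσ hjπ hDΘ hFN hΘn₀ hn₀1 hn₀N _).2 (by omega)
  have hiff := topBitLit_iff_of_rel hvρ (κ := ρ μ / μ) hω_r hrel (by rw [← exp_zero, exp_lt_exp]; have h1 := hD.2.2.2.2.2.1; omega) hψ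
  by_cases hχ : ∃ ω₁ : Kˣ, Valued.v (ω₁ : K) = 1 ∧
      Valued.v (1 + ρ h / h * (ρ (α ^ k₀ * Θ (α ^ k₀)) / (α ^ k₀ * Θ (α ^ k₀))) / (ρ μ / μ) * (ρ ((ω₁ : K) * Θ ω₁) / ((ω₁ : K) * Θ ω₁))) ≤
        exp (2 * (m : ℤ) - 2 * a - 2 * j - dρ)
  · rw [if_pos hχ, if_pos (hiff.1 hχ)]
  · rw [if_neg hχ, if_neg (fun h2 => hχ (hiff.2 h2))]

end Summit.HodgeConjecture.HodgeConjecture.Cruxes.H413.F0P3cDyRamToricLevelCensusRamM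

end
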